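import Mathlib.Geometry.Manifold.SmoothApprox
import Literature.Topology.FourManifolds.SphereMapsMissPoints
import Literature.Topology.FourManifolds.TwoKnotNormalTube
import HarnessLib

/-!
# The normal Euler class of an embedded `S² ⊆ S⁴` vanishes: a nowhere-zero normal field

Topic `Literature/Topology/FourManifolds`; third file of the decomposition of the named fact
`Literature.Topology.FourManifolds.TwoKnot.nonempty_normalFraming` (`FramedTubularNbhd.lean`), after
`TwoKnotNormalSection.lean` (orientation step, and the named fact
`Literature.Topology.FourManifolds.TwoKnot.nonempty_normalSection`) and `TwoKnotNormalTube.lean` (normal projections `Q_x`,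
nearest points, injectivity radius). Here we **prove** that every smooth embedding
`f : 𝕊² → 𝕊⁴` admits a `C^∞` vector field tangent to `𝕊⁴` and nowhere tangent to `f`
(`Literature.Topology.FourManifolds.TwoKnotNormalSection.exists_isNormalFraming_one`), i.e. a nowhere-zero cross-section of
the normal bundle `ν` — the statement "`χ(ν) = 0`" of Kirby, *The Topology of 4-Manifolds*
(1989), Ch. VIII, Thm. 2 (p. 44) for `M = S²`, `Q = S⁴`. The discharges
`TwoKnot.nonempty_normalSection_holds` / `TwoKnot.nonempty_normalFraming_holds` are in
`FramedTubularNbhdProofs.lean`.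

## The argument (Kirby's proof, pp. 44–45, made elementary)

Kirby: pull `ν` back over its total space `E(ν) ≅ N` (a tubular neighbourhood of `M` in `Q`);
off `M` the tautological section and the orientation trivialise the pull-back, so it extends by
the trivial bundle to a plane bundle `ξ` over `Q` with `ξ|_M = ν`; then `χ(ξ)` is Poincaré dual to
`[M] = 0`. We realise `ξ` concretely and replace the last (cohomological) sentence by the remark
that `M` misses a point `-a` of `Q = S⁴`, and over `S⁴ ∖ {-a}` — swept by the chords from `a` —
any plane bundle is trivialised by transport from `a`:

1. **The plane field `ξ`** (§ `Ops`, `PlaneField`): a family `P_z`, `z ∈ S⁴`, of idempotents of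
   `ℝ⁵ × ℝ²`, continuous in operator norm (`continuousOn_planeField`): within `ε/2` of `f(𝕊²)` it
   is `(p, q) ↦ (Q_{x(z)} p, 0)` with `x(z)` the nearest point (the pull-back of `ν` over the tube),
   beyond `ε` it is `(p, q) ↦ (0, q)` (the trivial bundle), and on the collar in between it is the
   projection onto the plane spanned by `cos θ (w/‖w‖, 0) + sin θ (0, e₀)` and
   `cos θ (Jw/‖Jw‖, 0) + sin θ (0, e₁)`, where `w = w(z) ∈ ν_{x(z)} ∖ 0` is the normal part of `z`
   (the tautological section, `wVec`), `J` the rotation by a right angle in the oriented normal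
   plane (the partner vector of `TwoKnotNormalSection.lean`, `jVec`) and `θ` runs from `0` to
   `π/2` across the collar (`mixOp`, `nFrame`, `collarParam`). Here `ε` is below the injectivity
   radius of `TwoKnotNormalTube.lean`, `1`, and `dist(a, f(𝕊²))`.
2. **Transport** (§ `Transport`, `Chord`): for a continuous family `H x t` of idempotents,
   `t ∈ [0, 1]`, uniform continuity gives `N` with `‖H x t_{k+1} - H x t_k‖ < 1` for
   `t_k = k/N`, and an idempotent within distance `1` of another kills no vector fixed by it
   (`apply_ne_zero_of_norm_sub_lt`); so `v ↦ H x t_N (⋯ (H x t_1 v))` carries a nonzero vector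
   fixed by `H x 0` to a nonzero vector fixed by `H x 1`, continuously in `x`
   (`exists_continuous_section`). Applied to `H x t = P_{γ_x(t)}` along the spherical chords
   `γ_x` from `a` to `f x` (`spath`, `chordField`), starting from `(0, e₀)` (fixed by
   `P_a = (p, q) ↦ (0, q)`), it yields a continuous `s₀` with `s₀ x ∈ ν_x ∖ 0`
   (`exists_continuous_normal`), since `P_{f x} = (p, q) ↦ (Q_x p, 0)`.
3. **Smoothing** (§ `Existence`): approximate `s₀` uniformly within `min ‖s₀‖ / 2` by a `C^∞` map
   (Mathlib's `Continuous.exists_contMDiff_approx`) and re-project by the smooth field `Q`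
   (`exists_contMDiff_normal`); the result is a normal `1`-framing
   (`exists_isNormalFraming_one`).

Embeddedness enters exactly once, through the injectivity radius (for an immersed sphere with
double points the nearest-point plane field is not defined, and indeed `χ(ν)` can be nonzero).

## References

* R. C. Kirby, *The Topology of 4-Manifolds*, LNM 1374, Springer (1989), Ch. VIII, Thm. 2 and its
  proof, pp. 44–45. [Kirby1989]
* M. W. Hirsch, *Differential Topology*, GTM 33, Springer (1976), Ch. 4, §5 (tubular
  neighbourhoods) and Ch. 5, §2, Thm. 2.10 (Euler number zero ⇒ nonvanishing section) —
  background; the transport argument above replaces the obstruction theory. [HirschDT1976]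

## Design notes

* The auxiliary fibre `ℝ⁵ × ℝ²` carries Mathlib's product (sup) norm; only the operator norm of
  differences of idempotents and the product structure are used, no inner product on the product.
* All idempotents are given by explicit formulas (`inOp`, `outOp`, `mixOp`), so that continuity
  of the field is continuity of its data; the three pieces are glued with `ContinuousOn.if` along
  the level sets `dist = ε/2`, `dist = ε` of the distance to `f(𝕊²)`, where they agree because an
  orthonormal pair of normal vectors spans the (`2`-dimensional) normal plane
  (`mixOp_nFrame_one_zero`) and `mixOp u 0 1 = outOp`.
* Everything is proved; no named facts, no `sorry`.
-/

open scoped Manifold ContDiff Topology RealInnerProductSpace NNReal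
open Set Function Metric Module Filter

noncomputable section

namespace Literature.Topology.FourManifolds

/-- Local notation: `𝔼 n` is the model Euclidean space `EuclideanSpace ℝ (Fin n)`. -/
local notation "𝔼 " n:arg => EuclideanSpace ℝ (Fin n)

/-- Local notation: `𝕊 n` is the unit sphere in `EuclideanSpace ℝ (Fin (n + 1))`. -/
local notation "𝕊 " n:arg => (Metric.sphere (0 : EuclideanSpace ℝ (Fin (n + 1))) 1)

/-- Local notation: `𝔽 = ℝ⁵ × ℝ²`, the fibre of the trivial bundle carrying the plane field. -/
local notation "𝔽" => (EuclideanSpace ℝ (Fin 5) × EuclideanSpace ℝ (Fin 2))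

namespace TwoKnotNormalSection

/-! ### Three families of idempotents on `ℝ⁵ × ℝ²` -/

section Ops

/-- The **inner idempotent** `(p, q) ↦ (Q p, 0)` attached to an operator `Q` on `ℝ⁵`. [folklore] -/
def inOp (Q : 𝔼 5 →L[ℝ] 𝔼 5) : 𝔽 →L[ℝ] 𝔽 :=
  (ContinuousLinearMap.inl ℝ (𝔼 5) (𝔼 2)).comp (Q.comp (ContinuousLinearMap.fst ℝ (𝔼 5) (𝔼 2)))

/-- Unfolding of `inOp`. [folklore] -/
@[simp]
theorem inOp_apply (Q : 𝔼 5 →L[ℝ] 𝔼 5) (v : 𝔽) : inOp Q v = (Q v.1, 0) := rfl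

/-- The **outer idempotent** `(p, q) ↦ (0, q)`. [folklore] -/
def outOp : 𝔽 →L[ℝ] 𝔽 :=
  (ContinuousLinearMap.inr ℝ (𝔼 5) (𝔼 2)).comp (ContinuousLinearMap.snd ℝ (𝔼 5) (𝔼 2))

/-- Unfolding of `outOp`. [folklore] -/
@[simp]
theorem outOp_apply (v : 𝔽) : outOp v = (0, v.2) := rfl

/-- The coefficient functionals `αᵢ(p, q) = c ⟪uᵢ, p⟫ + s qᵢ` of the mixed idempotent. [folklore] -/
def mixCoeff (u : Fin 2 → 𝔼 5) (c s : ℝ) (i : Fin 2) : 𝔽 →L[ℝ] ℝ :=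
  c • (innerSL ℝ (u i)).comp (ContinuousLinearMap.fst ℝ (𝔼 5) (𝔼 2)) +
    s • (EuclideanSpace.proj i).comp (ContinuousLinearMap.snd ℝ (𝔼 5) (𝔼 2))

/-- Unfolding of `mixCoeff`. [folklore] -/
@[simp]
theorem mixCoeff_apply (u : Fin 2 → 𝔼 5) (c s : ℝ) (i : Fin 2) (v : 𝔽) :
    mixCoeff u c s i v = c * ⟪u i, v.1⟫ + s * v.2 i := by
  simp [mixCoeff]

/-- The **mixed idempotent** of a pair of vectors `u₀, u₁ ∈ ℝ⁵` and an angle `(c, s)`: the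
orthogonal projection of `ℝ⁵ × ℝ²` onto the plane spanned by the orthonormal pair
`fᵢ = (c uᵢ, s eᵢ)` when `(u₀, u₁)` is orthonormal and `c² + s² = 1` — it rotates the plane
`span(u₀, u₁) × 0` (`(c, s) = (1, 0)`) to the plane `0 × ℝ²` (`(c, s) = (0, 1)`). [folklore] -/
def mixOp (u : Fin 2 → 𝔼 5) (c s : ℝ) : 𝔽 →L[ℝ] 𝔽 :=
  ∑ i : Fin 2, (mixCoeff u c s i).smulRight ((c • u i, s • EuclideanSpace.single i (1 : ℝ)) : 𝔽)

/-- Unfolding of `mixOp`. [folklore] -/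
theorem mixOp_apply (u : Fin 2 → 𝔼 5) (c s : ℝ) (v : 𝔽) :
    mixOp u c s v = ∑ i : Fin 2, (c * ⟪u i, v.1⟫ + s * v.2 i) •
      ((c • u i, s • EuclideanSpace.single i (1 : ℝ)) : 𝔽) := by
  simp [mixOp]

/-- First component of `mixOp`. [folklore] -/
theorem mixOp_apply_fst (u : Fin 2 → 𝔼 5) (c s : ℝ) (v : 𝔽) :
    (mixOp u c s v).1 = ∑ i : Fin 2, ((c * ⟪u i, v.1⟫ + s * v.2 i) * c) • u i := by
  rw [mixOp_apply, Prod.fst_sum]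
  simp [smul_smul]

/-- Second component of `mixOp`. [folklore] -/
theorem mixOp_apply_snd (u : Fin 2 → 𝔼 5) (c s : ℝ) (v : 𝔽) :
    (mixOp u c s v).2 = ∑ i : Fin 2, ((c * ⟪u i, v.1⟫ + s * v.2 i) * s) •
      EuclideanSpace.single i (1 : ℝ) := by
  rw [mixOp_apply, Prod.snd_sum]
  simp [smul_smul]

/-- At the angle `(1, 0)` the mixed idempotent is `(p, q) ↦ (∑ ⟪uᵢ, p⟫ uᵢ, 0)`. [folklore] -/
theorem mixOp_one_zero (u : Fin 2 → 𝔼 5) (v : 𝔽) :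
    mixOp u 1 0 v = (∑ i : Fin 2, ⟪u i, v.1⟫ • u i, 0) := by
  ext1
  · rw [mixOp_apply_fst]; simp
  · rw [mixOp_apply_snd]; simp

/-- At the angle `(0, 1)` the mixed idempotent is the outer idempotent. [folklore] -/
theorem mixOp_zero_one (u : Fin 2 → 𝔼 5) (v : 𝔽) : mixOp u 0 1 v = outOp v := by
  ext1
  · rw [mixOp_apply_fst]; simp
  · rw [mixOp_apply_snd, outOp_apply]
    simpa using (EuclideanSpace.basisFun (Fin 2) ℝ).sum_repr v.2

/-- The coefficients of `mixOp v` are those of `v` (orthonormal `u`, `c² + s² = 1`). [folklore] -/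
theorem mixCoeff_mixOp {u : Fin 2 → 𝔼 5} (hu : Orthonormal ℝ u) {c s : ℝ} (hcs : c ^ 2 + s ^ 2 = 1)
    (i : Fin 2) (v : 𝔽) : mixCoeff u c s i (mixOp u c s v) = mixCoeff u c s i v := by
  have h00 : ‖u 0‖ = 1 := hu.1 0
  have h11 : ‖u 1‖ = 1 := hu.1 1
  have h01 : ⟪u 0, u 1⟫ = 0 := hu.2 (by decide)
  have h10 : ⟪u 1, u 0⟫ = 0 := hu.2 (by decide)
  rw [mixCoeff_apply, mixCoeff_apply, mixOp_apply_fst, mixOp_apply_snd]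
  simp only [Fin.sum_univ_two, inner_add_right, inner_smul_right, WithLp.ofLp_add,
    WithLp.ofLp_smul, Pi.add_apply, Pi.smul_apply, smul_eq_mul]
  fin_cases i
  · simp [h00, h01]
    linear_combination (c * ⟪u 0, v.1⟫ + s * v.2 0) * hcs
  · simp [h11, h10]
    linear_combination (c * ⟪u 1, v.1⟫ + s * v.2 1) * hcs

/-- **The mixed operator is idempotent** for an orthonormal pair and `c² + s² = 1`. [folklore] -/
theorem mixOp_mixOp {u : Fin 2 → 𝔼 5} (hu : Orthonormal ℝ u) {c s : ℝ} (hcs : c ^ 2 + s ^ 2 = 1)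
    (v : 𝔽) : mixOp u c s (mixOp u c s v) = mixOp u c s v := by
  have h : ∀ i, mixCoeff u c s i (mixOp u c s v) = mixCoeff u c s i v :=
    fun i => mixCoeff_mixOp hu hcs i v
  simp only [mixCoeff_apply] at h
  conv_lhs => rw [mixOp_apply]
  conv_rhs => rw [mixOp_apply]
  exact Finset.sum_congr rfl fun i _ => by rw [h i]

/-- `inOp Q` is idempotent when `Q` is. [folklore] -/
theorem inOp_inOp {Q : 𝔼 5 →L[ℝ] 𝔼 5} (hQ : ∀ p, Q (Q p) = Q p) (v : 𝔽) :
    inOp Q (inOp Q v) = inOp Q v := by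
  simp [hQ]

/-- `outOp` is idempotent. [folklore] -/
theorem outOp_outOp (v : 𝔽) : outOp (outOp v) = outOp v := rfl

/-- `inOp` is continuous in `Q`. [folklore] -/
theorem continuous_inOp : Continuous (inOp : (𝔼 5 →L[ℝ] 𝔼 5) → 𝔽 →L[ℝ] 𝔽) :=
  continuous_const.clm_comp (continuous_id.clm_comp continuous_const)

/-- `mixOp` is a smooth function of its data `(u, c, s)` (a polynomial). [folklore] -/
theorem contDiff_mixOp :
    ContDiff ℝ ∞ fun t : (Fin 2 → 𝔼 5) × ℝ × ℝ => mixOp t.1 t.2.1 t.2.2 := by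
  unfold mixOp mixCoeff
  refine ContDiff.sum fun i _ => ?_
  have hu : ContDiff ℝ ∞ fun t : (Fin 2 → 𝔼 5) × ℝ × ℝ => t.1 i :=
    (contDiff_apply ℝ (𝔼 5) i).comp contDiff_fst
  have hc : ContDiff ℝ ∞ fun t : (Fin 2 → 𝔼 5) × ℝ × ℝ => t.2.1 := contDiff_fst.comp contDiff_snd
  have hs : ContDiff ℝ ∞ fun t : (Fin 2 → 𝔼 5) × ℝ × ℝ => t.2.2 := contDiff_snd.comp contDiff_snd
  refine ContDiff.smulRight ?_ ?_
  · exact (hc.smul (((innerSL ℝ (E := 𝔼 5)).contDiff.comp hu).clm_comp contDiff_const)).add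
      (hs.smul contDiff_const)
  · exact (hc.smul hu).prodMk (hs.smul contDiff_const)

/-- `mixOp` is continuous in its data `(u, c, s)`. [folklore] -/
theorem continuous_mixOp :
    Continuous fun t : (Fin 2 → 𝔼 5) × ℝ × ℝ => mixOp t.1 t.2.1 t.2.2 :=
  contDiff_mixOp.continuous

/-- **Transport step**: if `‖P' - P‖ < 1` then `P'` does not kill any nonzero vector fixed by `P`.
[folklore] -/
theorem apply_ne_zero_of_norm_sub_lt {P P' : 𝔽 →L[ℝ] 𝔽} {v : 𝔽} (hv : P v = v) (hv0 : v ≠ 0)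
    (h : ‖P' - P‖ < 1) : P' v ≠ 0 := by
  intro h0
  have hvpos : 0 < ‖v‖ := norm_pos_iff.2 hv0
  have h1 : ‖v‖ ≤ ‖P' - P‖ * ‖v‖ := by
    calc ‖v‖ = ‖(P' - P) v‖ := by rw [sub_apply, h0, hv, zero_sub, norm_neg]
      _ ≤ ‖P' - P‖ * ‖v‖ := (P' - P).le_opNorm v
  have h2 : ‖P' - P‖ * ‖v‖ < 1 * ‖v‖ := by gcongr
  linarith

end Ops

/-! ### The plane field -/

section PlaneField

variable {f : 𝕊 2 → 𝕊 4}

variable (f) in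
/-- The **normal part** `w(z) = z - ⟪z, f x⟫ f x`, `x = nearPt f z`, of a point `z`: for `z` in the
tube it is the normal vector `Q_x z ∈ ν_x` with `‖w(z)‖² + (1 - ⟪z, f x⟫)² = dist(z, f(𝕊²))²`.
[folklore] -/
def wVec (z : 𝔼 5) : 𝔼 5 :=
  z - ⟪z, (f (nearPt f z) : 𝔼 5)⟫ • (f (nearPt f z) : 𝔼 5)

variable (f) in
/-- The **rotated normal part** `J w(z)`: the partner vector of `w(z)` at `x = nearPt f z`.
[folklore] -/
def jVec (z : 𝔼 5) : 𝔼 5 :=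
  partnerVec (f (nearPt f z) : 𝔼 5) (wVec f z) (dExt f (nearPt f z)) (nearPt f z : 𝔼 3)

variable (f) in
/-- The **normal frame** `(w/‖w‖, Jw/‖Jw‖)` of a point of the tube off the core. [folklore] -/
def nFrame (z : 𝔼 5) : Fin 2 → 𝔼 5 := ![‖wVec f z‖⁻¹ • wVec f z, ‖jVec f z‖⁻¹ • jVec f z]

variable (f) in
/-- The image `f(𝕊²) ⊆ ℝ⁵`. [folklore] -/
def img : Set (𝔼 5) := range fun x : 𝕊 2 => (f x : 𝔼 5)

variable (f) in
/-- The collar parameter `λ(z) = 2 dist(z, f(𝕊²)) / ε - 1` (`0` on the inner boundary of the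
collar `{ε/2 ≤ dist ≤ ε}`, `1` on the outer). [folklore] -/
def collarParam (ε : ℝ) (z : 𝔼 5) : ℝ := 2 * infDist z (img f) / ε - 1

variable (f) in
/-- **The plane field** `P_z`, `z ∈ ℝ⁵` (used on `S⁴`): the family of idempotents of `ℝ⁵ × ℝ²`
equal to `(p, q) ↦ (Q_{x(z)} p, 0)` within `ε/2` of `f(𝕊²)` (`x(z)` the nearest point), to
`(p, q) ↦ (0, q)` beyond `ε`, and on the collar in between to the projection onto the plane spanned
by `cos θ · (w/‖w‖, 0) + sin θ · (0, e₀)` and `cos θ · (Jw/‖Jw‖, 0) + sin θ · (0, e₁)`,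
`θ = (π/2) λ(z)`. This is Kirby's plane bundle `ξ ⊇ ν` over `Q = S⁴` — the pull-back of the
normal bundle to its tubular neighbourhood, glued to the trivial bundle by the tautological
section `w` and the orientation `J` — realised inside the trivial bundle `S⁴ × (ℝ⁵ × ℝ²)`.
[cite: Kirby1989, Ch. VIII, proof of Thm. 2, pp. 44–45] -/
def planeField (ε : ℝ) (z : 𝔼 5) : 𝔽 →L[ℝ] 𝔽 :=
  if infDist z (img f) ≤ ε / 2 then inOp (norProj f (nearPt f z))
  else if infDist z (img f) ≤ ε then
    mixOp (nFrame f z) (Real.cos (Real.pi / 2 * collarParam f ε z))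
      (Real.sin (Real.pi / 2 * collarParam f ε z))
  else outOp

/-! #### Pointwise facts on the tube -/

section Pointwise

variable (hf : ContMDiff (𝓡 2) (𝓡 4) ∞ f) (hf' : ∀ x, Injective (mfderiv (𝓡 2) (𝓡 4) f x))
include hf hf'

omit hf hf' in
/-- The image is compact. [folklore] -/
theorem isCompact_img (hcont : Continuous f) : IsCompact (img f) :=
  isCompact_range (continuous_subtype_val.comp hcont)

omit hf hf' in
/-- Image points have distance `0` to the image. [folklore] -/
theorem infDist_coe_img (x : 𝕊 2) : infDist (f x : 𝔼 5) (img f) = 0 :=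
  infDist_zero_of_mem ⟨x, rfl⟩

/-- The normal part is the normal projection of `z` at its nearest point. [folklore] -/
theorem wVec_eq_norProj (z : 𝔼 5) : wVec f z = norProj f (nearPt f z) z :=
  (norProj_eq_sub_of_forall_inner_dExt hf hf' (nearPt f z) z (inner_dExt_nearPt hf z)).symm

/-- The normal part is a normal vector. [folklore] -/
theorem norProj_wVec (z : 𝔼 5) : norProj f (nearPt f z) (wVec f z) = wVec f z := by
  rw [wVec_eq_norProj hf hf', norProj_norProj hf hf']

omit hf hf' in
/-- `‖w(z)‖² + ⟪z, f x⟫² = ‖z‖²` (`x` the nearest point). [folklore] -/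
theorem norm_wVec_sq_add (z : 𝔼 5) :
    ‖wVec f z‖ ^ 2 + ⟪z, (f (nearPt f z) : 𝔼 5)⟫ ^ 2 = ‖z‖ ^ 2 := by
  have h1 : ‖(f (nearPt f z) : 𝔼 5)‖ = 1 := norm_eq_of_mem_sphere _
  rw [wVec, norm_sub_sq_real, norm_smul, h1, mul_one, inner_smul_right, Real.norm_eq_abs, sq_abs]
  ring

omit hf hf' in
/-- **Off the core of the tube the normal part is nonzero**: for `z ∈ S⁴` with
`0 < dist(z, f(𝕊²)) = ‖z - f x‖ < 2` (`x` the nearest point). [folklore] -/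
theorem wVec_ne_zero (hcont : Continuous f) {z : 𝔼 5} (hz : ‖z‖ = 1) (h0 : 0 < infDist z (img f))
    (h2 : infDist z (img f) < 2) : wVec f z ≠ 0 := by
  intro hw
  set x := nearPt f z with hx
  have h1 : ‖(f x : 𝔼 5)‖ = 1 := norm_eq_of_mem_sphere (f x)
  have hdist : ‖z - f x‖ = infDist z (img f) := norm_sub_nearPt hcont z
  have hz' : z = ⟪z, (f x : 𝔼 5)⟫ • (f x : 𝔼 5) := by
    rw [← sub_eq_zero]; exact hw
  have habs : |⟪z, (f x : 𝔼 5)⟫| = 1 := by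
    have := congrArg norm hz'
    rwa [norm_smul, h1, mul_one, hz, Real.norm_eq_abs, eq_comm] at this
  rcases abs_eq (zero_le_one' ℝ) |>.1 habs with h | h
  · -- `z = f x`: distance `0`
    have : ‖z - (f x : 𝔼 5)‖ = 0 := by
      conv_lhs => rw [hz', h, one_smul, sub_self]
      exact norm_zero
    rw [hdist] at this
    exact h0.ne' this
  · -- `z = -f x`: distance `2`
    have : ‖z - (f x : 𝔼 5)‖ = 2 := by
      conv_lhs => rw [hz', h, neg_one_smul, ← neg_add', norm_neg, ← two_smul ℝ]
      rw [norm_smul, h1, Real.norm_eq_abs]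
      norm_num
    rw [hdist] at this
    linarith

/-- The rotated normal part is a normal vector. [folklore] -/
theorem norProj_jVec (z : 𝔼 5) : norProj f (nearPt f z) (jVec f z) = jVec f z :=
  norProj_partnerVec hf hf' _ _

omit hf hf' in
/-- The rotated normal part is orthogonal to the normal part. [folklore] -/
theorem inner_jVec_wVec (z : 𝔼 5) : ⟪jVec f z, wVec f z⟫ = 0 :=
  inner_partnerVec_self _ _

/-- Off the core of the tube the rotated normal part is nonzero. [folklore] -/
theorem jVec_ne_zero {z : 𝔼 5} (hw : wVec f z ≠ 0) : jVec f z ≠ 0 :=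
  partnerVec_ne_zero_of_norProj_eq hf hf' _ (norProj_wVec hf hf' z) hw

/-- **The normal frame is orthonormal** off the core of the tube. [folklore] -/
theorem orthonormal_nFrame {z : 𝔼 5} (hw : wVec f z ≠ 0) : Orthonormal ℝ (nFrame f z) := by
  have hj := jVec_ne_zero hf hf' hw
  have hwn : ‖wVec f z‖ ≠ 0 := norm_ne_zero_iff.2 hw
  have hjn : ‖jVec f z‖ ≠ 0 := norm_ne_zero_iff.2 hj
  have e0 : nFrame f z 0 = ‖wVec f z‖⁻¹ • wVec f z := rfl
  have e1 : nFrame f z 1 = ‖jVec f z‖⁻¹ • jVec f z := rfl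
  refine ⟨fun i => ?_, fun i j hij => ?_⟩
  · fin_cases i
    · change ‖nFrame f z 0‖ = 1
      rw [e0, norm_smul, norm_inv, norm_norm, inv_mul_cancel₀ hwn]
    · change ‖nFrame f z 1‖ = 1
      rw [e1, norm_smul, norm_inv, norm_norm, inv_mul_cancel₀ hjn]
  · fin_cases i <;> fin_cases j
    · exact absurd rfl hij
    · change ⟪nFrame f z 0, nFrame f z 1⟫ = 0
      rw [e0, e1, inner_smul_left, inner_smul_right, real_inner_comm (jVec f z) (wVec f z),
        inner_jVec_wVec, mul_zero, mul_zero]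
    · change ⟪nFrame f z 1, nFrame f z 0⟫ = 0
      rw [e0, e1, inner_smul_left, inner_smul_right, inner_jVec_wVec, mul_zero, mul_zero]
    · exact absurd rfl hij

/-- The normal frame consists of normal vectors. [folklore] -/
theorem norProj_nFrame (z : 𝔼 5) (i : Fin 2) :
    norProj f (nearPt f z) (nFrame f z i) = nFrame f z i := by
  fin_cases i
  · simp [nFrame, map_smul, norProj_wVec hf hf']
  · simp [nFrame, map_smul, norProj_jVec hf hf']

/-- **Matching on the inner boundary of the collar**: off the core, `mixOp (nFrame z) 1 0` is the
inner idempotent of the normal projection at the nearest point (an orthonormal pair of normal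
vectors spans the normal plane). [folklore] -/
theorem mixOp_nFrame_one_zero {z : 𝔼 5} (hw : wVec f z ≠ 0) :
    mixOp (nFrame f z) 1 0 = inOp (norProj f (nearPt f z)) := by
  refine ContinuousLinearMap.ext fun v => ?_
  rw [mixOp_one_zero, inOp_apply, norProj_eq_sum_inner_smul hf hf' (nearPt f z)
    (orthonormal_nFrame hf hf' hw) (norProj_nFrame hf hf' z)]

/-- **The plane field consists of idempotents** (at points of `S⁴`, for `0 < ε < 2`). [folklore] -/
theorem planeField_planeField {ε : ℝ} (hε : 0 < ε) (hε2 : ε < 2) {z : 𝔼 5} (hz : ‖z‖ = 1) (v : 𝔽) :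
    planeField f ε z (planeField f ε z v) = planeField f ε z v := by
  unfold planeField
  split_ifs with h1 h2
  · exact inOp_inOp (norProj_norProj hf hf' _) v
  · have hw : wVec f z ≠ 0 :=
      wVec_ne_zero hf.continuous hz (by push Not at h1; linarith) (h2.trans_lt hε2)
    exact mixOp_mixOp (orthonormal_nFrame hf hf' hw) (Real.cos_sq_add_sin_sq _) v
  · rfl

omit hf hf' in
/-- Far from the image the plane field is the outer idempotent. [folklore] -/
theorem planeField_eq_outOp {ε : ℝ} (hε : 0 < ε) {z : 𝔼 5} (hz : ε < infDist z (img f)) :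
    planeField f ε z = outOp := by
  unfold planeField
  rw [if_neg (by linarith), if_neg (by linarith)]

omit hf' in
/-- **On the image the plane field is the normal projection**: `P_{f x} = (p, q) ↦ (Q_x p, 0)`
(within an injectivity radius, so that `x` is the nearest point of `f x`). [folklore] -/
theorem planeField_coe {ε : ℝ} (hε : 0 < ε) (hr : IsInjRadius f ε) (x : 𝕊 2) :
    planeField f ε (f x) = inOp (norProj f x) := by
  unfold planeField
  rw [if_pos (by rw [infDist_coe_img]; linarith), hr.nearPt_coe hε.le hf]

end Pointwise

/-! #### Continuity of the plane field on `S⁴` -/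

section Continuity

variable (hf : ContMDiff (𝓡 2) (𝓡 4) ∞ f) (hf' : ∀ x, Injective (mfderiv (𝓡 2) (𝓡 4) f x))
include hf hf'

omit hf' in
/-- The normal part is continuous on the tube (within an injectivity radius). [folklore] -/
theorem continuousOn_wVec {ε : ℝ} (hr : IsInjRadius f ε) :
    ContinuousOn (wVec f) {z | infDist z (img f) ≤ ε} := by
  have hπ := hr.continuousOn_nearPt hf
  have hfc : Continuous fun x : 𝕊 2 => (f x : 𝔼 5) := (contMDiff_coe_comp hf).continuous
  have hfx : ContinuousOn (fun z => (f (nearPt f z) : 𝔼 5)) {z | infDist z (img f) ≤ ε} :=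
    hfc.comp_continuousOn hπ
  have h2 : ContinuousOn (fun z => ⟪z, (f (nearPt f z) : 𝔼 5)⟫ • (f (nearPt f z) : 𝔼 5))
      {z | infDist z (img f) ≤ ε} := (continuousOn_id.inner hfx).fun_smul hfx
  exact continuousOn_id.sub h2

omit hf' in
/-- The rotated normal part is continuous on the tube. [folklore] -/
theorem continuousOn_jVec {ε : ℝ} (hr : IsInjRadius f ε) :
    ContinuousOn (jVec f) {z | infDist z (img f) ≤ ε} := by
  haveI := Fact.mk (@finrank_euclideanSpace_fin ℝ _ (2 + 1))
  have hπ := hr.continuousOn_nearPt hf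
  have hfE := contMDiff_coe_comp hf
  have hfc : Continuous fun x : 𝕊 2 => (f x : 𝔼 5) := hfE.continuous
  have hD : Continuous fun x : 𝕊 2 => dExt f x := (contMDiff_fderiv_sphExt hfE).continuous
  have hdata : ContinuousOn (fun z => ((f (nearPt f z) : 𝔼 5), wVec f z, dExt f (nearPt f z),
      ((nearPt f z : 𝕊 2) : 𝔼 3))) {z | infDist z (img f) ≤ ε} :=
    (hfc.comp_continuousOn hπ).prodMk ((continuousOn_wVec hf hr).prodMk
      ((hD.comp_continuousOn hπ).prodMk (continuous_subtype_val.comp_continuousOn hπ)))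
  have := continuous_partnerVec.comp_continuousOn hdata
  exact this

/-- The normal frame is continuous on the part of the tube in `S⁴` off the core. [folklore] -/
theorem continuousOn_nFrame {ε : ℝ} (hε2 : ε < 2) (hr : IsInjRadius f ε) :
    ContinuousOn (nFrame f) {z | infDist z (img f) ≤ ε ∧ 0 < infDist z (img f) ∧ ‖z‖ = 1} := by
  have hsub : {z : 𝔼 5 | infDist z (img f) ≤ ε ∧ 0 < infDist z (img f) ∧ ‖z‖ = 1} ⊆
      {z | infDist z (img f) ≤ ε} := fun z hz => hz.1
  have hw := (continuousOn_wVec hf hr).mono hsub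
  have hj := (continuousOn_jVec hf hr).mono hsub
  have hw0 : ∀ z ∈ {z : 𝔼 5 | infDist z (img f) ≤ ε ∧ 0 < infDist z (img f) ∧ ‖z‖ = 1},
      wVec f z ≠ 0 := fun z hz => wVec_ne_zero hf.continuous hz.2.2 hz.2.1 (hz.1.trans_lt hε2)
  have hj0 : ∀ z ∈ {z : 𝔼 5 | infDist z (img f) ≤ ε ∧ 0 < infDist z (img f) ∧ ‖z‖ = 1},
      jVec f z ≠ 0 := fun z hz => jVec_ne_zero hf hf' (hw0 z hz)
  have h0 : ContinuousOn (fun z => ‖wVec f z‖⁻¹ • wVec f z) _ :=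
    (hw.norm.inv₀ fun z hz => norm_ne_zero_iff.2 (hw0 z hz)).smul hw
  have h1 : ContinuousOn (fun z => ‖jVec f z‖⁻¹ • jVec f z) _ :=
    (hj.norm.inv₀ fun z hz => norm_ne_zero_iff.2 (hj0 z hz)).smul hj
  rw [continuousOn_pi]
  intro i
  fin_cases i
  · exact h0
  · exact h1

omit hf hf' in
/-- The collar parameter is continuous. [folklore] -/
theorem continuous_collarParam (ε : ℝ) : Continuous (collarParam f ε) :=
  ((continuous_const.mul (continuous_infDist_pt _)).div_const ε).sub continuous_const

/-- **The plane field is continuous on `S⁴`** (for `0 < ε < 2` an injectivity radius): the three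
pieces are continuous on their closed domains and agree on the interfaces
(`mixOp_nFrame_one_zero`, `mixOp_zero_one`). [folklore] -/
theorem continuousOn_planeField {ε : ℝ} (hε : 0 < ε) (hε2 : ε < 2) (hr : IsInjRadius f ε) :
    ContinuousOn (planeField f ε) (sphere (0 : 𝔼 5) 1) := by
  have hρ : Continuous fun z : 𝔼 5 => infDist z (img f) := continuous_infDist_pt _
  have hQ : Continuous fun x : 𝕊 2 => norProj f x := continuous_norProj hf hf'
  have hπ := hr.continuousOn_nearPt hf
  -- piece 1 on `{dist ≤ ε/2}`
  have h1 : ContinuousOn (fun z => inOp (norProj f (nearPt f z)))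
      (sphere (0 : 𝔼 5) 1 ∩ closure {z | infDist z (img f) ≤ ε / 2}) := by
    refine (continuous_inOp.comp_continuousOn (hQ.comp_continuousOn (hπ.mono ?_)))
    rw [(isClosed_le hρ continuous_const).closure_eq]
    rintro z ⟨-, hz⟩
    exact (show infDist z (img f) ≤ ε / 2 from hz).trans (by linarith)
  -- piece 2 on `{ε/2 ≤ dist ≤ ε} ∩ S⁴`
  have h2 : ContinuousOn (fun z => mixOp (nFrame f z) (Real.cos (Real.pi / 2 * collarParam f ε z))
      (Real.sin (Real.pi / 2 * collarParam f ε z)))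
      {z | infDist z (img f) ≤ ε ∧ 0 < infDist z (img f) ∧ ‖z‖ = 1} := by
    have hc := continuous_collarParam (f := f) ε
    have hcs : Continuous fun z => (Real.cos (Real.pi / 2 * collarParam f ε z),
        Real.sin (Real.pi / 2 * collarParam f ε z)) :=
      (Real.continuous_cos.comp (continuous_const.mul hc)).prodMk
        (Real.continuous_sin.comp (continuous_const.mul hc))
    have := continuous_mixOp.comp_continuousOn
      ((continuousOn_nFrame hf hf' hε2 hr).prodMk hcs.continuousOn)
    exact this
  -- pieces 2 and 3 on `{ε/2 ≤ dist} ∩ S⁴`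
  have h23 : ContinuousOn (fun z => if infDist z (img f) ≤ ε then
      mixOp (nFrame f z) (Real.cos (Real.pi / 2 * collarParam f ε z))
        (Real.sin (Real.pi / 2 * collarParam f ε z)) else outOp)
      (sphere (0 : 𝔼 5) 1 ∩ closure {z | ¬infDist z (img f) ≤ ε / 2}) := by
    refine ContinuousOn.if ?_ ?_ continuousOn_const
    · -- interface `dist = ε`
      rintro z ⟨⟨-, -⟩, hz⟩
      have hzε : infDist z (img f) = ε := frontier_le_subset_eq hρ continuous_const hz
      have hlam : collarParam f ε z = 1 := by
        rw [collarParam, hzε]; field_simp; ring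
      rw [hlam, mul_one, Real.cos_pi_div_two, Real.sin_pi_div_two]
      exact ContinuousLinearMap.ext (mixOp_zero_one _)
    · refine h2.mono ?_
      rintro z ⟨⟨hz1, hz2⟩, hz3⟩
      rw [(isClosed_le hρ continuous_const).closure_eq] at hz3
      refine ⟨hz3, ?_, by simpa using hz1⟩
      have : ε / 2 ≤ infDist z (img f) := by
        have := closure_lt_subset_le continuous_const hρ (by simpa [not_le] using hz2)
        exact this
      linarith
  -- assemble
  unfold planeField
  refine ContinuousOn.if ?_ h1 h23
  -- interface `dist = ε/2`
  rintro z ⟨hz, hfr⟩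
  have hzε : infDist z (img f) = ε / 2 := frontier_le_subset_eq hρ continuous_const hfr
  have hz1 : ‖z‖ = 1 := by simpa using hz
  rw [if_pos (by linarith)]
  have hlam : collarParam f ε z = 0 := by
    rw [collarParam, hzε]; field_simp; ring
  rw [hlam, mul_zero, Real.cos_zero, Real.sin_zero]
  have hw : wVec f z ≠ 0 := wVec_ne_zero hf.continuous hz1 (by linarith) (by linarith)
  exact (mixOp_nFrame_one_zero hf hf' hw).symm

end Continuity

end PlaneField

/-! ### Transport of a vector through a one-parameter family of idempotents -/

section Transport

/-- **Discrete parallel transport**: let `H x t` (`x` in a compact metric space, `t ∈ [0, 1]`) be a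
jointly continuous family of idempotents of `ℝ⁵ × ℝ²`, all fixing a nonzero vector `v₀` at
`t = 0`. Then there is a continuous nowhere-zero `σ` with `σ x` fixed by `H x 1`: transport `v₀`
along `t` in `N` steps `v ↦ H x t_{k+1} v`, where `N` is so large that consecutive idempotents
are within operator-norm distance `1` (uniform continuity), so that no step kills a vector
(`apply_ne_zero_of_norm_sub_lt`). This replaces "a bundle over a contractible base is
trivial" in Kirby's argument. [folklore] -/
theorem exists_continuous_section {X : Type*} [PseudoMetricSpace X] [CompactSpace X]
    (H : X → unitInterval → 𝔽 →L[ℝ] 𝔽) (hH : Continuous fun p : X × unitInterval => H p.1 p.2)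
    (hidem : ∀ x t v, H x t (H x t v) = H x t v) {v₀ : 𝔽} (hv₀ : v₀ ≠ 0)
    (h0 : ∀ x, H x 0 v₀ = v₀) :
    ∃ σ : X → 𝔽, Continuous σ ∧ ∀ x, H x 1 (σ x) = σ x ∧ σ x ≠ 0 := by
  -- uniform continuity: a modulus for operator-norm distance `1`
  have hU : UniformContinuous fun p : X × unitInterval => H p.1 p.2 :=
    CompactSpace.uniformContinuous_of_continuous hH
  obtain ⟨δ, hδ, hδU⟩ := Metric.uniformContinuous_iff.1 hU 1 one_pos
  obtain ⟨N, hN⟩ := exists_nat_one_div_lt hδ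
  set M : ℕ := N + 1 with hM
  have hMpos : (0 : ℝ) < M := by positivity
  -- the subdivision `t_k = k / M`
  let tk : ℕ → unitInterval := fun k => Set.projIcc (0 : ℝ) 1 zero_le_one (k / M)
  have htk : ∀ k, k ≤ M → ((tk k : unitInterval) : ℝ) = k / M := by
    intro k hk
    have hmem : (k : ℝ) / M ∈ Icc (0 : ℝ) 1 :=
      ⟨by positivity, div_le_one_of_le₀ (by exact_mod_cast hk) hMpos.le⟩
    simp only [tk, Set.projIcc_of_mem _ hmem]
  have htk0 : tk 0 = 0 := by
    simp only [tk, Nat.cast_zero, zero_div, Set.projIcc_left, Set.Icc.mk_zero]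
  have htkM : tk M = 1 := by
    simp only [tk, div_self hMpos.ne', Set.projIcc_right, Set.Icc.mk_one]
  have hclose : ∀ k, k + 1 ≤ M → ∀ x, ‖H x (tk (k + 1)) - H x (tk k)‖ < 1 := by
    intro k hk x
    have hd : dist ((x, tk (k + 1)) : X × unitInterval) (x, tk k) < δ := by
      rw [Prod.dist_eq, dist_self, max_eq_right dist_nonneg, Subtype.dist_eq, htk _ hk,
        htk _ (Nat.le_of_succ_le hk), Real.dist_eq, Nat.cast_succ, add_div, add_sub_cancel_left,
        abs_of_pos (by positivity)]
      calc (1 : ℝ) / M = 1 / ((N : ℝ) + 1) := by rw [hM, Nat.cast_succ]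
        _ < δ := hN
    have := hδU hd
    rwa [dist_eq_norm] at this
  -- the transported vectors
  let σ : ℕ → X → 𝔽 := fun k => Nat.rec (fun _ => v₀) (fun k σk x => H x (tk (k + 1)) (σk x)) k
  have hσ0 : σ 0 = fun _ => v₀ := rfl
  have hσs : ∀ k, σ (k + 1) = fun x => H x (tk (k + 1)) (σ k x) := fun k => rfl
  have hHc : ∀ t, Continuous fun x => H x t := fun t =>
    hH.comp (continuous_id.prodMk continuous_const)
  have key : ∀ k, k ≤ M → Continuous (σ k) ∧ ∀ x, H x (tk k) (σ k x) = σ k x ∧ σ k x ≠ 0 := by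
    intro k
    induction k with
    | zero =>
      intro _
      refine ⟨by rw [hσ0]; exact continuous_const, fun x => ⟨?_, by rw [hσ0]; exact hv₀⟩⟩
      rw [hσ0, htk0]
      exact h0 x
    | succ k ih =>
      intro hk
      obtain ⟨hc, hfix⟩ := ih (Nat.le_of_succ_le hk)
      refine ⟨?_, fun x => ⟨?_, ?_⟩⟩
      · rw [hσs]
        exact (hHc _).clm_apply hc
      · rw [hσs]
        exact hidem x _ _
      · rw [hσs]
        exact apply_ne_zero_of_norm_sub_lt (hfix x).1 (hfix x).2 (hclose k hk x)
  obtain ⟨hc, hfix⟩ := key M le_rfl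
  refine ⟨σ M, hc, fun x => ?_⟩
  have := hfix x
  rwa [htkM] at this

end Transport

/-! ### Chords of `S⁴` from a base point -/

section Chord

/-- A chord `(1 - t) a + t y` between unit vectors with `y ≠ -a` avoids the origin (for every real
`t`). [folklore] -/
theorem chord_ne_zero {a y : 𝔼 5} (ha : ‖a‖ = 1) (hy : ‖y‖ = 1) (hya : y ≠ -a) (t : ℝ) :
    (1 - t) • a + t • y ≠ 0 := by
  intro h
  have h1 : (1 - t) • a = -(t • y) := eq_neg_of_add_eq_zero_left h
  have h2 : |1 - t| = |t| := by
    have := congrArg norm h1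
    rwa [norm_smul, norm_neg, norm_smul, ha, hy, mul_one, mul_one, Real.norm_eq_abs,
      Real.norm_eq_abs] at this
  have ht : t = 1 / 2 := by
    rcases abs_eq_abs.1 h2 with h3 | h3 <;> linarith
  rw [ht] at h
  have h4 : a + y = 0 := by
    have : (2 : ℝ) • ((1 - 1 / 2 : ℝ) • a + (1 / 2 : ℝ) • y) = a + y := by
      rw [smul_add, smul_smul, smul_smul]; norm_num
    rw [← this, h, smul_zero]
  exact hya (eq_neg_of_add_eq_zero_right h4)

/-- The **spherical chord path** `t ↦ ((1 - t) a + t y)/‖(1 - t) a + t y‖` from `a` to `y` on the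
unit sphere. [folklore] -/
def spath (a y : 𝔼 5) (t : ℝ) : 𝔼 5 :=
  ‖(1 - t) • a + t • y‖⁻¹ • ((1 - t) • a + t • y)

/-- The spherical chord path lies on the unit sphere. [folklore] -/
theorem norm_spath {a y : 𝔼 5} (ha : ‖a‖ = 1) (hy : ‖y‖ = 1) (hya : y ≠ -a) (t : ℝ) :
    ‖spath a y t‖ = 1 := by
  rw [spath, norm_smul, norm_inv, norm_norm,
    inv_mul_cancel₀ (norm_ne_zero_iff.2 (chord_ne_zero ha hy hya t))]

/-- The path starts at `a`. [folklore] -/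
theorem spath_zero {a y : 𝔼 5} (ha : ‖a‖ = 1) : spath a y 0 = a := by
  simp [spath, ha]

/-- The path ends at `y`. [folklore] -/
theorem spath_one {a y : 𝔼 5} (hy : ‖y‖ = 1) : spath a y 1 = y := by
  simp [spath, hy]

/-- The spherical chord path is jointly continuous in `(y, t)` on `{y ≠ -a}`. [folklore] -/
theorem continuousOn_spath {a : 𝔼 5} (ha : ‖a‖ = 1) :
    ContinuousOn (fun p : 𝔼 5 × ℝ => spath a p.1 p.2) {p | ‖p.1‖ = 1 ∧ p.1 ≠ -a} := by
  have hc : Continuous fun p : 𝔼 5 × ℝ => (1 - p.2) • a + p.2 • p.1 :=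
    ((continuous_const.sub continuous_snd).smul continuous_const).add
      (continuous_snd.smul continuous_fst)
  have hn : ContinuousOn (fun p : 𝔼 5 × ℝ => ‖(1 - p.2) • a + p.2 • p.1‖⁻¹)
      {p | ‖p.1‖ = 1 ∧ p.1 ≠ -a} :=
    (hc.continuousOn.norm).inv₀ fun p hp => norm_ne_zero_iff.2 (chord_ne_zero ha hp.1 hp.2 _)
  exact hn.fun_smul hc.continuousOn

end Chord

/-! ### The continuous nowhere-zero normal field -/

section Existence

variable {f : 𝕊 2 → 𝕊 4}

variable (f) in
/-- The plane field read along the spherical chord from `a` to `f x`: the one-parameter family of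
idempotents through which normal vectors are transported. [folklore] -/
def chordField (ε : ℝ) (a : 𝔼 5) (x : 𝕊 2) (t : unitInterval) : 𝔽 →L[ℝ] 𝔽 :=
  planeField f ε (spath a (f x) t)

/-- The spherical chords from `a` to the points `f x` depend continuously on `(x, t)` (when no
`f x` is antipodal to `a`). [folklore] -/
theorem continuous_spath_coe (hfc : Continuous fun x : 𝕊 2 => (f x : 𝔼 5)) {a : 𝔼 5}
    (ha1 : ‖a‖ = 1) (hya : ∀ x : 𝕊 2, (f x : 𝔼 5) ≠ -a) :
    Continuous fun p : 𝕊 2 × unitInterval => spath a (f p.1) (p.2 : ℝ) := by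
  have hc : Continuous fun p : 𝕊 2 × unitInterval =>
      (1 - (p.2 : ℝ)) • a + (p.2 : ℝ) • (f p.1 : 𝔼 5) :=
    ((continuous_const.sub (continuous_subtype_val.comp continuous_snd)).smul
      continuous_const).add
      ((continuous_subtype_val.comp continuous_snd).smul (hfc.comp continuous_fst))
  have hn : Continuous fun p : 𝕊 2 × unitInterval =>
      ‖(1 - (p.2 : ℝ)) • a + (p.2 : ℝ) • (f p.1 : 𝔼 5)‖⁻¹ :=
    hc.norm.inv₀ fun p => norm_ne_zero_iff.2
      (chord_ne_zero ha1 (norm_eq_of_mem_sphere (f p.1)) (hya p.1) _)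
  exact hn.smul hc

/-- **The chord field is jointly continuous** in `(x, t)`. [folklore] -/
theorem continuous_chordField (hf : ContMDiff (𝓡 2) (𝓡 4) ∞ f)
    (hf' : ∀ x, Injective (mfderiv (𝓡 2) (𝓡 4) f x)) {ε : ℝ} (hε : 0 < ε) (hε2 : ε < 2)
    (hr : IsInjRadius f ε) {a : 𝔼 5} (ha1 : ‖a‖ = 1) (hya : ∀ x : 𝕊 2, (f x : 𝔼 5) ≠ -a) :
    Continuous fun p : 𝕊 2 × unitInterval => chordField f ε a p.1 p.2 := by
  have hγ := continuous_spath_coe (contMDiff_coe_comp hf).continuous ha1 hya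
  have hP := continuousOn_planeField hf hf' hε hε2 hr
  have hmem : ∀ p : 𝕊 2 × unitInterval, spath a (f p.1) (p.2 : ℝ) ∈ sphere (0 : 𝔼 5) 1 :=
    fun p => mem_sphere_zero_iff_norm.2
      (norm_spath ha1 (norm_eq_of_mem_sphere (f p.1)) (hya p.1) _)
  have := hP.comp_continuous hγ hmem
  exact this

/-- The chord field consists of idempotents. [folklore] -/
theorem chordField_chordField (hf : ContMDiff (𝓡 2) (𝓡 4) ∞ f)
    (hf' : ∀ x, Injective (mfderiv (𝓡 2) (𝓡 4) f x)) {ε : ℝ} (hε : 0 < ε) (hε2 : ε < 2)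
    {a : 𝔼 5} (ha1 : ‖a‖ = 1) (hya : ∀ x : 𝕊 2, (f x : 𝔼 5) ≠ -a) (x : 𝕊 2) (t : unitInterval)
    (v : 𝔽) : chordField f ε a x t (chordField f ε a x t v) = chordField f ε a x t v :=
  planeField_planeField hf hf' hε hε2 (norm_spath ha1 (norm_eq_of_mem_sphere (f x)) (hya x) _) v

/-- At `t = 0` the chord field is `P_a`, the outer idempotent when `a` is far from the image.
[folklore] -/
theorem chordField_zero {ε : ℝ} (hε : 0 < ε) {a : 𝔼 5} (ha1 : ‖a‖ = 1)
    (hεa : ε < infDist a (img f)) (x : 𝕊 2) : chordField f ε a x 0 = outOp := by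
  rw [chordField, Set.Icc.coe_zero, spath_zero ha1, planeField_eq_outOp hε hεa]

/-- At `t = 1` the chord field is `P_{f x} = inOp Q_x`. [folklore] -/
theorem chordField_one (hf : ContMDiff (𝓡 2) (𝓡 4) ∞ f) {ε : ℝ} (hε : 0 < ε)
    (hr : IsInjRadius f ε) (a : 𝔼 5) (x : 𝕊 2) : chordField f ε a x 1 = inOp (norProj f x) := by
  rw [chordField, Set.Icc.coe_one, spath_one (norm_eq_of_mem_sphere (f x)), planeField_coe hf hε hr]

/-- **A continuous nowhere-zero normal field along a smooth embedding `f : 𝕊² → 𝕊⁴`**: a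
continuous `s₀ : 𝕊² → ℝ⁵` with `Q_x (s₀ x) = s₀ x ≠ 0`. Proof: choose a base point `a ∈ S⁴` with
`±a ∉ f(𝕊²)` and a radius `ε` below the injectivity radius, `1`, and `dist(a, f(𝕊²))`; transport
the vector `(0, e₀)`, fixed by `P_a = outOp`, through the plane field along the spherical chords
from `a` to `f x` (`exists_continuous_section`); the result is fixed by `P_{f x} = inOp Q_x`, i.e.
it is `(s₀ x, 0)` with `s₀ x ∈ ν_x ∖ 0`. [cite: Kirby1989, Ch. VIII, proof of Thm. 2, pp. 44–45] -/
theorem exists_continuous_normal (hf : ContMDiff (𝓡 2) (𝓡 4) ∞ f)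
    (hf' : ∀ x, Injective (mfderiv (𝓡 2) (𝓡 4) f x)) (hinj : Injective f) :
    ∃ s₀ : 𝕊 2 → 𝔼 5, Continuous s₀ ∧ ∀ x : 𝕊 2, norProj f x (s₀ x) = s₀ x ∧ s₀ x ≠ 0 := by
  haveI := Fact.mk (@finrank_euclideanSpace_fin ℝ _ (4 + 1))
  have hfc : Continuous fun x : 𝕊 2 => (f x : 𝔼 5) := (contMDiff_coe_comp hf).continuous
  -- base point `a` with `±a ∉ f(𝕊²)`
  obtain ⟨a, ha, ha'⟩ := exists_notMem_range_neg_notMem_range_of_contMDiff (by norm_num : 2 < 4)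
    (hf.of_le (by exact_mod_cast le_top))
  have ha1 : ‖(a : 𝔼 5)‖ = 1 := norm_eq_of_mem_sphere a
  have hya : ∀ x : 𝕊 2, (f x : 𝔼 5) ≠ -(a : 𝔼 5) := by
    intro x hx
    exact ha' ⟨x, Subtype.ext (by rw [hx]; rfl)⟩
  have hdist : 0 < infDist (a : 𝔼 5) (img f) := by
    have hcl : IsClosed (img f) := (isCompact_img hf.continuous).isClosed
    refine (hcl.notMem_iff_infDist_pos ⟨_, ⟨spherePt 2, rfl⟩⟩).1 ?_
    rintro ⟨x, hx⟩
    exact ha ⟨x, Subtype.ext hx⟩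
  -- the radius
  obtain ⟨ε₀, hε₀, hr₀⟩ := exists_isInjRadius hf hf' hinj
  set ε : ℝ := min ε₀ (min 1 (infDist (a : 𝔼 5) (img f) / 2)) with hε
  have hεpos : 0 < ε := by
    simp only [hε, lt_min_iff]; exact ⟨hε₀, one_pos, by linarith⟩
  have hε2 : ε < 2 := by
    have : ε ≤ 1 := (min_le_right _ _).trans (min_le_left _ _)
    linarith
  have hεa : ε < infDist (a : 𝔼 5) (img f) := by
    have : ε ≤ infDist (a : 𝔼 5) (img f) / 2 := (min_le_right _ _).trans (min_le_right _ _)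
    linarith
  have hr : IsInjRadius f ε := hr₀.mono (min_le_left _ _)
  -- the family of idempotents along the chords, and the initial vector `(0, e₀)`
  have hH := continuous_chordField hf hf' hεpos hε2 hr ha1 hya
  set v₀ : 𝔽 := ((0 : 𝔼 5), EuclideanSpace.single (0 : Fin 2) (1 : ℝ)) with hv₀
  have hv₀0 : v₀ ≠ 0 := by
    intro h
    have := congrArg (fun v : 𝔽 => v.2 0) h
    simp [hv₀] at this
  have h0 : ∀ x, chordField f ε a x 0 v₀ = v₀ := by
    intro x
    rw [chordField_zero hεpos ha1 hεa]
    rfl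
  obtain ⟨σ, hσc, hσ⟩ := exists_continuous_section (chordField f ε a) hH
    (chordField_chordField hf hf' hεpos hε2 ha1 hya) hv₀0 h0
  -- read off the normal field at `t = 1`
  refine ⟨fun x => (σ x).1, continuous_fst.comp hσc, fun x => ?_⟩
  obtain ⟨hfix, hne⟩ := hσ x
  rw [chordField_one hf hεpos hr] at hfix
  have hfst : norProj f x (σ x).1 = (σ x).1 := congrArg Prod.fst hfix
  have hsnd : (σ x).2 = 0 := by
    have := congrArg Prod.snd hfix
    simpa using this.symm
  refine ⟨hfst, fun h => hne ?_⟩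
  exact Prod.ext h hsnd

/-- **A smooth nowhere-zero normal field along a smooth embedding `f : 𝕊² → 𝕊⁴`**, obtained from
the continuous one by smooth approximation (Mathlib's `Continuous.exists_contMDiff_approx`) and
re-projection onto the normal planes by the smooth field `Q`.
[cite: Kirby1989, Ch. VIII, Thm. 2] -/
theorem exists_contMDiff_normal (hf : ContMDiff (𝓡 2) (𝓡 4) ∞ f)
    (hf' : ∀ x, Injective (mfderiv (𝓡 2) (𝓡 4) f x)) (hinj : Injective f) :
    ∃ s : 𝕊 2 → 𝔼 5, ContMDiff (𝓡 2) 𝓘(ℝ, 𝔼 5) ∞ s ∧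
      ∀ x : 𝕊 2, norProj f x (s x) = s x ∧ s x ≠ 0 := by
  haveI := Fact.mk (@finrank_euclideanSpace_fin ℝ _ (2 + 1))
  obtain ⟨s₀, hs₀c, hs₀⟩ := exists_continuous_normal hf hf' hinj
  -- a positive lower bound for `‖s₀‖`
  obtain ⟨x₀, -, hx₀⟩ := isCompact_univ.exists_isMinOn ⟨spherePt 2, mem_univ _⟩
    hs₀c.norm.continuousOn
  set m : ℝ := ‖s₀ x₀‖ with hm
  have hmpos : 0 < m := norm_pos_iff.2 (hs₀ x₀).2
  have hmle : ∀ x, m ≤ ‖s₀ x‖ := fun x => hx₀ (mem_univ x)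
  -- smooth approximation within `m / 2`
  obtain ⟨g, hg, -⟩ := hs₀c.exists_contMDiff_approx (𝓡 2) (⊤ : ℕ∞) (ε := fun _ => m / 2)
    continuous_const (fun _ => half_pos hmpos)
  refine ⟨fun x : 𝕊 2 => norProj f x (g x), (contMDiff_norProj hf hf').clm_apply g.contMDiff,
    fun x => ⟨norProj_norProj hf hf' x _, fun h0 => ?_⟩⟩
  -- `‖Q g - s₀‖ ≤ ‖g - s₀‖ < m/2` contradicts `Q g = 0`, `‖s₀‖ ≥ m`
  have h1 : ‖norProj f x (g x) - s₀ x‖ < m / 2 := by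
    have : norProj f x (g x) - s₀ x = norProj f x (g x - s₀ x) := by
      rw [map_sub, (hs₀ x).1]
    rw [this]
    exact (norm_norProj_le hf hf' x _).trans_lt (by rw [← dist_eq_norm]; exact hg x)
  have h0' : norProj f x (g x) = 0 := h0
  rw [h0', zero_sub, norm_neg] at h1
  linarith [hmle x]

/-- **Main theorem** (Kirby, Ch. VIII, Thm. 2 for `S² ⊆ S⁴`, the "non-zero cross-section"): every
smooth embedding `f : 𝕊² → 𝕊⁴` admits a normal `1`-framing — a `C^∞` vector field tangent to
`𝕊⁴` and nowhere tangent to `f`. [cite: Kirby1989, Ch. VIII Thm. 2] -/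
theorem exists_isNormalFraming_one (hf : ContMDiff (𝓡 2) (𝓡 4) ∞ f)
    (hf' : ∀ x, Injective (mfderiv (𝓡 2) (𝓡 4) f x)) (hinj : Injective f) :
    ∃ s : 𝕊 2 → 𝔼 5, IsNormalFraming (𝓡 2) f (fun _ : Fin 1 => s) := by
  obtain ⟨s, hs, hsn⟩ := exists_contMDiff_normal hf hf' hinj
  refine ⟨s, ⟨fun _ => hs, fun _ x => ?_, fun x v a h => ?_⟩⟩
  · rw [← (hsn x).1]
    exact inner_norProj_coe hf hf' x _
  · simp only [Finset.univ_unique, Fin.default_eq_zero, Fin.isValue, Finset.sum_singleton] at h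
    have h2 := congrArg (norProj f x) h
    rw [map_add, map_smul, norProj_ambientDeriv hf hf' x, (hsn x).1, zero_add, map_zero,
      smul_eq_zero] at h2
    funext i
    rw [Subsingleton.elim i 0]
    exact h2.resolve_right (hsn x).2

end Existence

end TwoKnotNormalSection

end Literature.Topology.FourManifolds
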